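import Summits.CriticalPhenomena.PercolationContinuityZ3.Theorems.PercNearOneGluingNoHeavyLowerTailCSHPsiTools
import Summits.CriticalPhenomena.PercolationContinuityZ3.Theorems.PercNearOneGluingNoHeavyLowerTailKNConj4PreMargin
import HarnessLib

/-!
# The EVENT-REFINED pre-FKG surplus margin from the pinned hierarchy (the two-observer inequality (II)_𝓗 at every decoy level)

Support file (`--supports stmt-CriticalPhenomena-4575`), route task `nh-dp-fatminority` (line fat-minority-linear, gen 15).
Memo `run/shared/lean/prim/prim-nh-dp-fatminority/CSH-PSI-MEMO.md` §3.  No definitions, no named facts, no sorries.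

`PinCSH.preMargin_nonneg_of_pin` — verbatim prim-ineq-gen-6's `PreFKGSurplus.preMargin_nonneg_of_csh` (the pre-FKG peeling of
Kozma–Nitzan's Conjecture 4 from the conditioned slack hierarchy) with the first observer `o` REFINED by the increasing cluster
event `E = {C_o ∈ 𝓗}`: with `Δ^E_o(X) := ∫_{E ∩ {o↔X}} (F(C o) − F(C c))` at the label `o` and the plain `Δ_u(X) := ∫_{u↔X} (F(C u) − F(C c))`
elsewhere (`c ∈ X` of least mean), the level-form margin `Marg_{X,D}` built from the PINNED constants (`PinCSH.pDecoyList`,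
`PinCSH.pObsConst`) is `≥ 0` for every decoy list — IF the pinned hierarchy `PinCSH.Holds` (memo Theorem 1_ψ; hypothesis `hPin`, in
the shape of `CSH.cshAll`) is available for every owner / avoided set / decoy list.  The proof is the tree's, step for step: peel
`k ≠ c`; on the peeled piece at the label `o` the event is read on `C_k` (`{k↔o} ∩ E = PinCSH.pinEv o 𝓗 k`,
`PinCSH.pinEv_eq_inter_event`); tower along `σ(C_k)` (`CovTau.setIntegral_sub_eq_projFun`); the pinned hierarchy for the projected
monotone functional; Lemma AC through `Ψ_iso` (`PinCSH.pCovD_psiIso`); next rung `CSH.cshMarg_cons`; induction on `|X|`.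
`PinCSH.twoObserver_of_pin` — the case `D = []` cleared of its denominator:
`μ({k↮X'} ∩ {k↔o} ∩ {C_k ∈ 𝓗}) · Δ_k(X') ≤ μ(k↮X') · Δ^E_o(X')` — EXACTLY the hypothesis (II)_𝓗 of the gen-13 reduction
`RefinedPreFKG.conj4_refined_of_twoObserver` (there for vertex-set events; bridge in the sequel file).
[cite: KozmaNitzan2024, Conj. 4 (p. 32), Question 7 (p. 36)] [cite: VandenbergHaggstromKahn2005, Thm. 1.3 (p. 6), §2.1 Lemma 2.4 (p. 10)]
-/

noncomputable section

namespace Summit.CriticalPhenomena.PercolationContinuityZ3.Theorems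

open MeasureTheory Set Literature.Probability.LatticeModels Literature.Probability.Percolation
open scoped Classical
open KNPreFKG CSH PreFKGSurplus

namespace PinCSH

variable {n : ℕ}

/-- **The refined pre-FKG surplus margin from the pinned hierarchy (memo (pS5D)_ψ).**  Non-degenerate weights; the label `o` (first
observer, refined by the event `{C_o ∈ 𝓗}`) and the plain second observer `v`; HYPOTHESIS `hPin`: the pinned hierarchy `PinCSH.Holds`
for every owner / avoided set / decoy list with the named vertices distinct (memo Theorem 1_ψ).  Then for every relay set `X ∌ o, v`,
every `c ∈ X` of least mean, every decoy list `D` and every monotone `F`: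
`0 ≤ Marg_{X,D}[u ↦ Δ_u(X) (u ≠ o), o ↦ Δ^E_o(X)]` with the pinned constants.
[cite: KozmaNitzan2024, Conj. 4 (p. 32)] [cite: VandenbergHaggstromKahn2005, §2.1 Lemma 2.4 (p. 10)] -/
theorem preMargin_nonneg_of_pin (w : Sym2 (Fin n) → unitInterval) (hw : ∀ e, 0 < w e ∧ w e < 1) (o v : Fin n)
    (𝓗 : Set (Set (Sym2 (Fin n))))
    (hPin : ∀ (x : Fin n) (Y : Finset (Fin n)) (D : List (Fin n)),
      x ∉ Y → o ≠ x → v ≠ x → o ∉ Y → v ∉ Y → D.Nodup → (∀ d ∈ D, d ≠ x ∧ d ∉ Y ∧ d ≠ o ∧ d ≠ v) →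
      Holds w o 𝓗 x (↑Y : Set (Fin n)) D v) :
    ∀ (X : Finset (Fin n)) (c : Fin n) (D : List (Fin n)) (F : Set (Fin n) → ℝ),
      (∀ S S' : Set (Fin n), S ⊆ S' → F S ≤ F S') → c ∈ X →
      (∀ a ∈ X, ∫ ω, F (openCluster ω c) ∂(prodBernoulli w) ≤ ∫ ω, F (openCluster ω a) ∂(prodBernoulli w)) →
      o ∉ X → v ∉ X → D.Nodup → (∀ d ∈ D, d ∉ X ∧ d ≠ o ∧ d ≠ v) →
      0 ≤ cshMarg (pDecoyList w o 𝓗 (↑X : Set (Fin n)) D) (pObsConst w o 𝓗 v ((↑X : Set (Fin n)) ∪ {d | d ∈ D})) o v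
        (fun u => if u = o then
            ∫ ω in {ω : BondConfig (Fin n) | openEdgeCluster ω o ∈ 𝓗} ∩ ⋃ a ∈ X, openConn o a,
              (F (openCluster ω o) - F (openCluster ω c)) ∂(prodBernoulli w)
          else ∫ ω in ⋃ a ∈ X, openConn u a, (F (openCluster ω u) - F (openCluster ω c)) ∂(prodBernoulli w)) := by
  classical
  have main : ∀ (N : ℕ) (X : Finset (Fin n)) (c : Fin n) (D : List (Fin n)) (F : Set (Fin n) → ℝ), X.card = N →
      (∀ S S' : Set (Fin n), S ⊆ S' → F S ≤ F S') → c ∈ X →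
      (∀ a ∈ X, ∫ ω, F (openCluster ω c) ∂(prodBernoulli w) ≤ ∫ ω, F (openCluster ω a) ∂(prodBernoulli w)) →
      o ∉ X → v ∉ X → D.Nodup → (∀ d ∈ D, d ∉ X ∧ d ≠ o ∧ d ≠ v) →
      0 ≤ cshMarg (pDecoyList w o 𝓗 (↑X : Set (Fin n)) D) (pObsConst w o 𝓗 v ((↑X : Set (Fin n)) ∪ {d | d ∈ D})) o v
        (fun u => if u = o then
            ∫ ω in {ω : BondConfig (Fin n) | openEdgeCluster ω o ∈ 𝓗} ∩ ⋃ a ∈ X, openConn o a,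
              (F (openCluster ω o) - F (openCluster ω c)) ∂(prodBernoulli w)
          else ∫ ω in ⋃ a ∈ X, openConn u a, (F (openCluster ω u) - F (openCluster ω c)) ∂(prodBernoulli w)) := by
    intro N
    induction N using Nat.strong_induction_on with
    | _ N ih =>
    intro X c D F hN hF hcX hcmin hoX hvX hD hDX
    set μ := prodBernoulli w with hμ
    have hmeas : ∀ S : Set (BondConfig (Fin n)), MeasurableSet S := fun _ => MeasurableSet.of_discrete
    have hint : ∀ (g : BondConfig (Fin n) → ℝ), Integrable g μ := fun g => Integrable.of_finite
    have hn := fun (S : Set (BondConfig (Fin n))) => (measureReal_nonneg : 0 ≤ μ.real S)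
    have hoc : o ≠ c := fun h => hoX (h ▸ hcX)
    have hvc : v ≠ c := fun h => hvX (h ▸ hcX)
    set Eo : Set (BondConfig (Fin n)) := {ω : BondConfig (Fin n) | openEdgeCluster ω o ∈ 𝓗} with hEo
    -- the refined pre-FKG surplus as a function of the relay set
    set PS : Finset (Fin n) → (Fin n → ℝ) := fun Y u =>
      if u = o then ∫ ω in Eo ∩ ⋃ a ∈ Y, openConn o a, (F (openCluster ω o) - F (openCluster ω c)) ∂μ
      else ∫ ω in ⋃ a ∈ Y, openConn u a, (F (openCluster ω u) - F (openCluster ω c)) ∂μ with hPS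
    rcases (X.erase c).eq_empty_or_nonempty with h0 | hne
    · -- base: `X = {c}`, `Δ ≡ 0`
      have hXc : X = {c} := by
        rw [← Finset.insert_erase hcX, h0]; rfl
      have hzero : PS X = fun _ => 0 := by
        funext u
        simp only [hPS, hXc]
        have hU : ∀ z : Fin n, (⋃ a ∈ ({c} : Finset (Fin n)), (openConn z a : Set (BondConfig (Fin n)))) = openConn z c := by
          intro z; ext ω; simp
        split_ifs with huo
        · rw [hU]
          rw [setIntegral_congr_fun (hmeas _) (g := fun _ => (0 : ℝ)) (fun ω hω => by
            show F (openCluster ω o) - F (openCluster ω c) = 0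
            rw [openCluster_eq_of_reach (show (openGraph ω).Reachable o c from hω.2), sub_self])]
          simp
        · rw [hU]
          rw [setIntegral_congr_fun (hmeas _) (g := fun _ => (0 : ℝ)) (fun ω hω => by
            show F (openCluster ω u) - F (openCluster ω c) = 0
            rw [openCluster_eq_of_reach (show (openGraph ω).Reachable u c from hω), sub_self])]
          simp
      show 0 ≤ cshMarg _ _ o v (PS X)
      rw [hzero]
      simp only [cshMarg]
      rw [show (fun _ : Fin n => (0 : ℝ)) = (0 : Fin n → ℝ) from rfl, slForm_zero]
      simp
    -- step: peel some `k ∈ X`, `k ≠ c`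
    obtain ⟨k, hk⟩ := hne
    have hkc : k ≠ c := (Finset.mem_erase.1 hk).1
    have hkX : k ∈ X := (Finset.mem_erase.1 hk).2
    set X' : Finset (Fin n) := X.erase k with hX'
    have hXcard : X'.card < N := by
      rw [hX', Finset.card_erase_of_mem hkX]; have := Finset.card_pos.2 ⟨k, hkX⟩; omega
    have hX'X : ∀ a ∈ X', a ∈ X := fun a ha => Finset.mem_of_mem_erase ha
    have hkX' : k ∉ X' := Finset.notMem_erase k X
    have hcX' : c ∈ X' := Finset.mem_erase.2 ⟨hkc.symm, hcX⟩
    have hko : o ≠ k := fun h => hoX (h ▸ hkX)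
    have hkv : v ≠ k := fun h => hvX (h ▸ hkX)
    have hkD : k ∉ D := fun h => (hDX k h).1 hkX
    have hmk : ∫ ω, F (openCluster ω c) ∂μ ≤ ∫ ω, F (openCluster ω k) ∂μ := hcmin k hkX
    -- the objects
    set Dk : Set (BondConfig (Fin n)) := {ω : BondConfig (Fin n) | ∀ a ∈ (↑X' : Set (Fin n)), ¬ (openGraph ω).Reachable k a}
      with hDk
    set gk : BondConfig (Fin n) → ℝ := fun ω => F (openCluster ω k) - F (openCluster ω c) with hgk
    set L := pDecoyList w o 𝓗 (↑X : Set (Fin n)) D with hL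
    set p : ℝ := pObsConst w o 𝓗 v ((↑X : Set (Fin n)) ∪ {d | d ∈ D}) with hp
    set ck : Fin n → ℝ := pAvoidConst w o 𝓗 k (↑X' : Set (Fin n)) with hck
    -- the test events of the two kinds of rows on the peeled piece
    set tk : Fin n → Set (BondConfig (Fin n)) := fun u => if u = o then pinEv o 𝓗 k else openConn k u with htk
    -- the projected monotone functional of the peeled relay (benchmark `c`)
    set Gk : Set (Sym2 (Fin n)) → ℝ := fun K => F {z | z = k ∨ ∃ e ∈ K, z ∈ e} -
      ∫ η, F (openCluster (η \ BHK2006.barOf {k} K) c) ∂μ with hGk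
    have hGk_mono : Monotone Gk := CovTau.monotone_projFun w c k F hF
    set Tk : Fin n → ℝ := fun u => ∫ ω in Dk ∩ tk u, gk ω ∂μ with hTk
    set J : ℝ := ∫ ω in Dk, gk ω ∂μ with hJ
    -- positivity of the conditioning events (non-degenerate weights)
    have hempty_Dk : (∅ : BondConfig (Fin n)) ∈ Dk := by
      intro a ha h
      rw [HullPort.reachable_empty_iff] at h
      exact hkX' (h ▸ (Finset.mem_coe.1 ha))
    have hDkpos : 0 < μ.real Dk := prodBernoulli_real_pos_of_nonempty hw ⟨∅, hempty_Dk⟩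
    have hisopos : 0 < μ.real (Dk ∩ {ω | openEdgeCluster ω k = ∅}) :=
      prodBernoulli_real_pos_of_nonempty hw ⟨∅, hempty_Dk, subset_empty_iff.1 (openEdgeCluster_subset ∅ k)⟩
    -- set identities between the systems `(X; D)`, `(X'; k; D)` and `(X'; k :: D)`
    have hins : insert k (↑X' : Set (Fin n)) = ↑X := by
      rw [hX', Finset.coe_erase, insert_sdiff_singleton, insert_eq_of_mem (Finset.mem_coe.2 hkX)]
    have hset2 : (↑X' : Set (Fin n)) ∪ {d | d ∈ k :: D} = (↑X : Set (Fin n)) ∪ {d | d ∈ D} := by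
      ext a
      simp only [mem_union, Finset.mem_coe, hX', Finset.mem_erase, mem_setOf_eq, List.mem_cons]
      constructor
      · rintro (⟨_, ha⟩ | rfl | ha)
        · exact Or.inl ha
        · exact Or.inl hkX
        · exact Or.inr ha
      · rintro (ha | ha)
        · by_cases hak : a = k
          · exact Or.inr (Or.inl hak)
          · exact Or.inl ⟨hak, ha⟩
        · exact Or.inr (Or.inr ha)
    have hpMargin : ∀ f : Set (Sym2 (Fin n)) → ℝ,
        pMargin w o 𝓗 k (↑X' : Set (Fin n)) D v f = cshMarg L p o v (pCovD w o 𝓗 k (↑X' : Set (Fin n)) f) := by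
      intro f
      rw [pMargin, hins]
    have hnext : cshMarg (pDecoyList w o 𝓗 (↑X' : Set (Fin n)) (k :: D)) (pObsConst w o 𝓗 v ((↑X' : Set (Fin n)) ∪ {d | d ∈ k :: D})) o v (PS X') =
        cshMarg L p o v (PS X') - PS X' k * cshMarg L p o v ck := by
      rw [hset2, pDecoyList, hins, cshMarg_cons]
    -- (1) peel `k` (at the label: the event is read on `C_k` on the peeled piece)
    have hpeel : PS X = PS X' + Tk := by
      funext u
      rw [Pi.add_apply]
      simp only [hPS, hTk, htk]
      split_ifs with huo
      · subst huo
        -- refined peeling: `Eo ∩ {o↔X} = (Eo ∩ {o↔X'}) ⊔ (Dk ∩ {k↔o} ∩ Eo)` and `Dk ∩ {k↔o} ∩ Eo = Dk ∩ pinEv o 𝓗 k`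
        have hsplit : ∀ ω : BondConfig (Fin n), (Eo ∩ ⋃ a ∈ X, (openConn u a : Set (BondConfig (Fin n)))).indicator
            (fun ω => F (openCluster ω u) - F (openCluster ω c)) ω =
            (Eo ∩ ⋃ a ∈ X', (openConn u a : Set (BondConfig (Fin n)))).indicator (fun ω => F (openCluster ω u) - F (openCluster ω c)) ω +
              (Dk ∩ pinEv u 𝓗 k).indicator gk ω := by
          intro ω
          by_cases hE : ω ∈ Eo
          · by_cases h1 : ∃ a ∈ X', (openGraph ω).Reachable u a
            · obtain ⟨a, ha, hua⟩ := h1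
              have m1 : ω ∈ Eo ∩ ⋃ a ∈ X, (openConn u a : Set (BondConfig (Fin n))) :=
                ⟨hE, (mem_iUnion_openConn X u ω).2 ⟨a, Finset.mem_of_mem_erase ha, hua⟩⟩
              have m2 : ω ∈ Eo ∩ ⋃ a ∈ X', (openConn u a : Set (BondConfig (Fin n))) :=
                ⟨hE, (mem_iUnion_openConn _ u ω).2 ⟨a, ha, hua⟩⟩
              have m3 : ω ∉ Dk ∩ pinEv u 𝓗 k := fun h =>
                h.1 a (Finset.mem_coe.2 ha) ((show (openGraph ω).Reachable k u from h.2.1).trans hua)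
              rw [indicator_of_mem m1, indicator_of_mem m2, indicator_of_notMem m3, add_zero]
            · by_cases h2 : (openGraph ω).Reachable u k
              · have m1 : ω ∈ Eo ∩ ⋃ a ∈ X, (openConn u a : Set (BondConfig (Fin n))) :=
                  ⟨hE, (mem_iUnion_openConn X u ω).2 ⟨k, hkX, h2⟩⟩
                have m2 : ω ∉ Eo ∩ ⋃ a ∈ X', (openConn u a : Set (BondConfig (Fin n))) := fun h =>
                  h1 ((mem_iUnion_openConn _ u ω).1 h.2)
                have m3 : ω ∈ Dk ∩ pinEv u 𝓗 k := by
                  refine ⟨fun a ha hka => h1 ⟨a, Finset.mem_coe.1 ha, h2.trans hka⟩, h2.symm, ?_⟩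
                  have : openEdgeCluster ω k = openEdgeCluster ω u := attachSet_openEdgeCluster_eq_of_reachable h2.symm
                  show openEdgeCluster ω k ∈ 𝓗
                  rw [this]; exact hE
                rw [indicator_of_mem m1, indicator_of_notMem m2, indicator_of_mem m3, zero_add, hgk]
                simp only
                rw [openCluster_eq_of_reach h2]
              · have m1 : ω ∉ Eo ∩ ⋃ a ∈ X, (openConn u a : Set (BondConfig (Fin n))) := by
                  intro h
                  obtain ⟨a, ha, hua⟩ := (mem_iUnion_openConn X u ω).1 h.2
                  by_cases hak : a = k
                  · exact h2 (hak ▸ hua)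
                  · exact h1 ⟨a, Finset.mem_erase.2 ⟨hak, ha⟩, hua⟩
                have m2 : ω ∉ Eo ∩ ⋃ a ∈ X', (openConn u a : Set (BondConfig (Fin n))) := fun h =>
                  h1 ((mem_iUnion_openConn _ u ω).1 h.2)
                have m3 : ω ∉ Dk ∩ pinEv u 𝓗 k := fun h => h2 (show (openGraph ω).Reachable k u from h.2.1).symm
                rw [indicator_of_notMem m1, indicator_of_notMem m2, indicator_of_notMem m3, add_zero]
          · have m1 : ω ∉ Eo ∩ ⋃ a ∈ X, (openConn u a : Set (BondConfig (Fin n))) := fun h => hE h.1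
            have m2 : ω ∉ Eo ∩ ⋃ a ∈ X', (openConn u a : Set (BondConfig (Fin n))) := fun h => hE h.1
            have m3 : ω ∉ Dk ∩ pinEv u 𝓗 k := by
              intro h
              have : openEdgeCluster ω k = openEdgeCluster ω u :=
                attachSet_openEdgeCluster_eq_of_reachable (show (openGraph ω).Reachable k u from h.2.1)
              exact hE (by rw [hEo, mem_setOf_eq, ← this]; exact h.2.2)
            rw [indicator_of_notMem m1, indicator_of_notMem m2, indicator_of_notMem m3, add_zero]
        rw [← integral_indicator (hmeas _), ← integral_indicator (hmeas _), ← integral_indicator (hmeas _),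
          ← integral_add (hint _) (hint _)]
        exact integral_congr_ae (Filter.Eventually.of_forall hsplit)
      · exact preSurplus_erase_add w X F c k u hkX
    -- (2) tower: the peeled term and its total through the projected functional `Gk`
    have hDk_S : ∀ u : Fin n, u ≠ o → Dk ∩ tk u =
        {ω : BondConfig (Fin n) | ¬ (openGraph ω).Reachable k c} ∩
          {ω | openEdgeCluster ω k ∈ {K : Set (Sym2 (Fin n)) |
            (∀ a ∈ X', a ≠ c → ¬ (a = k ∨ ∃ e ∈ K, a ∈ e)) ∧ (u = k ∨ ∃ e ∈ K, u ∈ e)}} := by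
      intro u huo; ext ω
      simp only [mem_inter_iff, hDk, htk, if_neg huo, mem_setOf_eq, Finset.mem_coe]
      constructor
      · rintro ⟨h1, h2⟩
        refine ⟨h1 c hcX', fun a ha _ => ?_, (reachable_iff_exists_mem_openEdgeCluster ω k u).1 h2⟩
        rw [← reachable_iff_exists_mem_openEdgeCluster]; exact h1 a ha
      · rintro ⟨h1, h2, h3⟩
        refine ⟨fun a ha => ?_, (reachable_iff_exists_mem_openEdgeCluster ω k u).2 h3⟩
        by_cases hac : a = c
        · rw [hac]; exact h1
        · rw [reachable_iff_exists_mem_openEdgeCluster]; exact h2 a ha hac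
    have hDk_So : Dk ∩ tk o =
        {ω : BondConfig (Fin n) | ¬ (openGraph ω).Reachable k c} ∩
          {ω | openEdgeCluster ω k ∈ {K : Set (Sym2 (Fin n)) |
            (∀ a ∈ X', a ≠ c → ¬ (a = k ∨ ∃ e ∈ K, a ∈ e)) ∧ (o = k ∨ ∃ e ∈ K, o ∈ e) ∧ K ∈ 𝓗}} := by
      ext ω
      simp only [mem_inter_iff, hDk, htk, if_pos rfl, mem_pinEv, mem_setOf_eq, Finset.mem_coe]
      constructor
      · rintro ⟨h1, h2, h3⟩
        refine ⟨h1 c hcX', fun a ha _ => ?_, (reachable_iff_exists_mem_openEdgeCluster ω k o).1 h2, h3⟩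
        rw [← reachable_iff_exists_mem_openEdgeCluster]; exact h1 a ha
      · rintro ⟨h1, h2, h3, h4⟩
        refine ⟨fun a ha => ?_, (reachable_iff_exists_mem_openEdgeCluster ω k o).2 h3, h4⟩
        by_cases hac : a = c
        · rw [hac]; exact h1
        · rw [reachable_iff_exists_mem_openEdgeCluster]; exact h2 a ha hac
    have hDk_0 : Dk = {ω : BondConfig (Fin n) | ¬ (openGraph ω).Reachable k c} ∩
          {ω | openEdgeCluster ω k ∈ {K : Set (Sym2 (Fin n)) | ∀ a ∈ X', a ≠ c → ¬ (a = k ∨ ∃ e ∈ K, a ∈ e)}} := by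
      ext ω
      simp only [mem_inter_iff, hDk, mem_setOf_eq, Finset.mem_coe]
      constructor
      · intro h1
        refine ⟨h1 c hcX', fun a ha _ => ?_⟩
        rw [← reachable_iff_exists_mem_openEdgeCluster]; exact h1 a ha
      · rintro ⟨h1, h2⟩ a ha
        by_cases hac : a = c
        · rw [hac]; exact h1
        · rw [reachable_iff_exists_mem_openEdgeCluster]; exact h2 a ha hac
    have towU : ∀ u : Fin n, Tk u = ∫ ω in Dk ∩ tk u, Gk (openEdgeCluster ω k) ∂μ := by
      intro u
      simp only [hTk, hgk]
      by_cases huo : u = o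
      · rw [huo, hDk_So]
        exact CovTau.setIntegral_sub_eq_projFun w c k F _
      · rw [hDk_S u huo]
        exact CovTau.setIntegral_sub_eq_projFun w c k F _
    have tow0 : J = ∫ ω in Dk, Gk (openEdgeCluster ω k) ∂μ := by
      simp only [hJ, hgk]
      rw [hDk_0]
      exact CovTau.setIntegral_sub_eq_projFun w c k F _
    -- the total `J = (m_k − m_c) − Δ_k(X')`
    have hJtot : J = ((∫ ω, F (openCluster ω k) ∂μ) - ∫ ω, F (openCluster ω c) ∂μ) - PS X' k := by
      have h1 := integral_add_compl (hmeas Dk) (hint gk)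
      have hDkc : Dkᶜ = ⋃ a' ∈ X', (openConn k a' : Set (BondConfig (Fin n))) := by
        ext ω
        rw [mem_iUnion_openConn, mem_compl_iff, hDk]
        simp only [mem_setOf_eq, Finset.mem_coe, not_forall, not_not, exists_prop]
      have h2 : ∫ ω in Dkᶜ, gk ω ∂μ = PS X' k := by
        rw [hDkc]; simp only [hPS, if_neg hko.symm, hgk]
      have h3 : ∫ ω, gk ω ∂μ = (∫ ω, F (openCluster ω k) ∂μ) - ∫ ω, F (openCluster ω c) ∂μ := by
        rw [hgk, integral_sub (hint _) (hint _)]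
      rw [hJ]; linarith
    -- (2') the peeled term through `pCovD`
    have hTk_cov : (μ.real Dk) • Tk = pCovD w o 𝓗 k (↑X' : Set (Fin n)) Gk + J • ((μ.real Dk) • ck) := by
      funext u
      simp only [Pi.add_apply, Pi.smul_apply, smul_eq_mul]
      by_cases huo : u = o
      · subst huo
        have h2 : μ.real (Dk ∩ tk u) = μ.real Dk * ck u := by
          simp only [hck, pAvoidConst, htk, if_true, hDk]
          rw [mul_div_cancel₀ _ (ne_of_gt hDkpos)]
        rw [towU u]
        unfold pCovD
        rw [if_pos rfl, ← hDk, ← tow0]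
        simp only [htk, if_pos rfl] at h2 ⊢
        rw [h2]
        ring
      · have h2 : μ.real (Dk ∩ tk u) = μ.real Dk * ck u := by
          simp only [hck, pAvoidConst, htk, if_neg huo, CSH.avoidConst, hDk]
          rw [mul_div_cancel₀ _ (ne_of_gt hDkpos)]
        rw [towU u]
        unfold pCovD
        rw [if_neg huo]
        unfold CSH.covD
        rw [← hDk, ← tow0]
        simp only [htk, if_neg huo] at h2 ⊢
        rw [h2]
        ring
    -- (3) the pinned hierarchy for the peeled relay, functional `Gk`
    have hPink := hPin k X' D hkX' hko hkv (fun h => hoX (hX'X o h)) (fun h => hvX (hX'X v h)) hD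
      (fun d hd => ⟨fun h => hkD (h ▸ hd), fun h => (hDX d hd).1 (hX'X d h), (hDX d hd).2.1, (hDX d hd).2.2⟩)
    have h3 : 0 ≤ cshMarg L p o v (pCovD w o 𝓗 k (↑X' : Set (Fin n)) Gk) := by
      rw [← hpMargin]
      exact hPink Gk hGk_mono
    -- (4) Lemma AC: `Marg[c_k] ≥ 0` from the pinned hierarchy applied to `Ψ_iso`
    have h4 : 0 ≤ cshMarg L p o v ck := by
      have hiso := hPink psiIso psiIso_mono
      rw [hpMargin] at hiso
      have hLk : ∀ dc ∈ L, dc.1 ≠ k := fun dc hdc h => hkD (h ▸ mem_pDecoyList w o 𝓗 _ D dc hdc)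
      rw [cshMarg_congr L p o v (pCovD w o 𝓗 k (↑X' : Set (Fin n)) psiIso)
        ((μ.real (Dk ∩ {ω | openEdgeCluster ω k = ∅}) * μ.real Dk) • ck) (fun u => u ≠ k) hLk hko hkv
        (fun u hu => by
          rw [Pi.smul_apply, smul_eq_mul]
          by_cases huo : u = o
          · subst huo
            rw [pCovD_psiIso w u 𝓗 X' k hko]
            simp only [hck, pAvoidConst, if_true, hDk]
            rw [mul_assoc, mul_div_cancel₀ _ (ne_of_gt hDkpos)]
          · unfold pCovD
            rw [if_neg huo, covD_psiIso w X' k u hu]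
            simp only [hck, pAvoidConst, if_neg huo, CSH.avoidConst, hDk]
            rw [mul_assoc, mul_div_cancel₀ _ (ne_of_gt hDkpos)]), cshMarg_smul] at hiso
      exact (mul_nonneg_iff_of_pos_left (mul_pos hisopos hDkpos)).1 hiso
    -- (5) the replacement of Lemma κ: `J ≥ −Δ_k(X')` (only use of `m_c ≤ m_k`)
    have h5 : -PS X' k ≤ J := by rw [hJtot]; linarith [hmk]
    -- (6) the next rung by induction
    have h6 : 0 ≤ cshMarg (pDecoyList w o 𝓗 (↑X' : Set (Fin n)) (k :: D)) (pObsConst w o 𝓗 v ((↑X' : Set (Fin n)) ∪ {d | d ∈ k :: D})) o v (PS X') :=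
      ih X'.card hXcard X' c (k :: D) F rfl hF hcX' (fun a ha => hcmin a (hX'X a ha)) (fun h => hoX (hX'X o h)) (fun h => hvX (hX'X v h))
        (List.nodup_cons.2 ⟨hkD, hD⟩)
        (fun d hd => by
          rcases List.mem_cons.1 hd with rfl | hd
          · exact ⟨hkX', hko.symm, hkv.symm⟩
          · exact ⟨fun h => (hDX d hd).1 (hX'X d h), (hDX d hd).2.1, (hDX d hd).2.2⟩)
    -- (7) assemble
    have hmain : μ.real Dk * cshMarg L p o v (PS X) =
        μ.real Dk * cshMarg L p o v (PS X') + cshMarg L p o v (pCovD w o 𝓗 k (↑X' : Set (Fin n)) Gk) +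
          J * μ.real Dk * cshMarg L p o v ck := by
      have e1 : μ.real Dk * cshMarg L p o v Tk =
          cshMarg L p o v (pCovD w o 𝓗 k (↑X' : Set (Fin n)) Gk) + J * μ.real Dk * cshMarg L p o v ck := by
        rw [← cshMarg_smul, hTk_cov, cshMarg_add, cshMarg_smul, cshMarg_smul]; ring
      rw [hpeel, cshMarg_add, mul_add, e1]
      ring
    have hbound : μ.real Dk * cshMarg (pDecoyList w o 𝓗 (↑X' : Set (Fin n)) (k :: D))
        (pObsConst w o 𝓗 v ((↑X' : Set (Fin n)) ∪ {d | d ∈ k :: D})) o v (PS X') ≤ μ.real Dk * cshMarg L p o v (PS X) := by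
      rw [hmain, hnext]
      have := mul_le_mul_of_nonneg_right h5 (mul_nonneg hDkpos.le h4)
      nlinarith [h3, h4, this, hDkpos.le]
    show 0 ≤ cshMarg L p o v (PS X)
    exact le_of_mul_le_mul_left (by linarith [mul_nonneg hDkpos.le h6]) hDkpos
  intro X c D F hF hcX hcmin hoX hvX hD hDX
  exact main X.card X c D F rfl hF hcX hcmin hoX hvX hD hDX

end PinCSH

end Summit.CriticalPhenomena.PercolationContinuityZ3.Theorems
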